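/-
Copyright (c) 2026 the pub-hodgecm-mathlib formalisation cell (harness21).  Prover seat hodgecm-mathlib-LH4-p16 (g3), req620 Track A «(D-RAM) FOUR-FRAME» squad
((β₂) road (R-36), the K6 road (K6-ROAD-BRIEF v1 dfa84314) — β₂ sub-dealer LH4-p04 (g10) WORD #38 «K6-(e) INSTANTIATION»: the CORE letters' conclusion in its own currency
from the per-cell laws (★ p864195 K6-0 HEAD′ shape), ‹K6-(f) UNIFORM DENSITY›, the K6-(d) digit partition and ONE vanishing digit sum, over ★ p864238 (LH7-p06 (g3))), 2026-09-05.
-/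
import Summits.HodgeConjecture.HodgeConjecture.Theorems.F0P3cDyRamCoreWindowOfDigitSums   -- ★ p864238 (LH7-p06 (g3)): the abstract CORE arithmetic (`cellValue_eq_mul_sum_of_mul_card`, `sum_window_eq_sum_window_of_digit_partition`)
import Summits.HodgeConjecture.HodgeConjecture.Theorems.F0P3cDyRamToricCensusDefs          -- ★ DEFS: `levelSet`, `levelSetDep`, `levelSetDep_subset`
import Mathlib.Algebra.BigOperators.Finprod
import HarnessLib

/-!
# Crux `H413`, line LH4 «(D-RAM) FOUR-FRAME» — (β₂) road, K6-(e): «THE CORE WINDOW IDENTITY FROM THE PER-CELL LAWS» — the conclusion of ‹CORE.letter.v1› dd6c93c2 ∕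
# ‹CORE-3› 02fd4cfe ∕ ‹CORE-ODD.v1› eff69f00 in ITS OWN CURRENCY (weighted cell sums `Σᶠ_{levelSetDep …} f`), reduced to: one K6-0 law per listed cell and literal
# (★ p864195 HEAD′ shape, byte for byte), ‹K6-(f) UNIFORM DENSITY› per literal, ONE sign letter, the K6-(d) digit partition, and ONE vanishing digit sum

Cell `hodgecm-mathlib` (D-0151), FLOOR 0, crux item H413 = `stmt-HodgeConjecture-24833`, route of record `HCCMUnconditional`; squad F0∕P3c∕LH4 (hand LH4-p16 (g3), heir of
LH4-p16 (g2)'s K5∕K6 digit-line road, MECH-K3 d766981c); lane `--supports stmt-HodgeConjecture-24833 --as helper` (count-neutral; pays NO tier-0 row).  THEOREMS ONLY (no `def`,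
no instance, no notation, no `sorry`, default heartbeats); ★-only imports; states NO law: every mathematical input is a HYPOTHESIS named below.

WHAT (β₂ WORD #38; K6-ROAD-BRIEF §2 row K6-(e)).  The three CORE letters (‹CORE.letter.v1› dd6c93c2, ‹CORE-3› 02fd4cfe = CORE behind `3 ≤ d → tE < m → 4 ≤ m →`,
‹CORE-ODD.v1› eff69f00 = CORE with `2 * b + 1 = m`) share ONE conclusion shape: with the cells `C_t(i) := levelSetDep ρ Θ α ϖE h_t (b + 2i) b μ` of the live row (`ϖE = jE ϖ`,
`μ = lam − jE u₀₀`, `h_H = h`, `h_A = h'`), the weights `f_t b (b + 2i)` and the two label predicates `P_t`, `Q_t` of each literal (the `∃ B, … ∃ L₃, … LatticeNearTransvShell … ∧ (¬) VS = X₊`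
set-builders — here ABSTRACT sets `PH QH PA QA`, so the letters are instances by first-order unification),
`Σ_{i ∈ I_H} (Σᶠ_{C_H(i) ∩ P_H} f − Σᶠ_{C_H(i) ∩ Q_H} f) = Σ_{i ∈ I_A} (Σᶠ_{C_A(i) ∩ P_A} f' − Σᶠ_{C_A(i) ∩ Q_A} f')` (windows `I_H = range ((jl − m)∕2 + 1)`, `I_A = range (min … d)` —
here ABSTRACT `IH IA : Finset ℕ`).  HEAD §2 `coreWindow_of_perCellLaws` proves exactly this from:
* (K6-0) per listed cell and literal, the PER-CELL LAW in ★ p864195 `…ConeCellPerCellLaw.cellDiff_mul_card_eq_cellCount_mul_signSum_of_fibration_reads₃`'s OUTPUT SHAPE, byte for byte: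
  `X_t(i) · #S_t(i) = n_t(i) · (p_t · Σ_{V ∈ S′_t(i)} ω V)` with `n_t(i) := Σᶠ_{C_t(i)} f_t` the WEIGHTED size, `S_t(i)` the counted literal digits of the cell (the consumer's
  `Rd.filter LIT`), `S′_t(i) ⊆ S_t(i)` the labelled ones (`(Rd.filter LIT).filter NX`) — hypotheses `hmulH`, `hmulA` (one K6-0 instance each, supplied by the assembler);
* ‹K6-(f) UNIFORM DENSITY› (LH7-p06 (g3), SIG pending — THIS is its target shape): `n_t(i) = k_t · #S_t(i)`, ONE `k_t` per literal across the window — `hkH`, `hkA`;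
* the SIGN LETTER `k_A · p_A = −(k_H · p_H)` (MECH-K3 §2: `q_A = −q_H`, `p_A c_A = −p_H c_H`; with one density `k_H = k_A` this is ★ p864238's `p_A = −p_H`) — `hp`;
* the K6-(d) DIGIT PARTITION (LH7-p08 (g3), SIG pending — THIS is its target shape): the labelled digit sets of all listed cells of both literals lie in one digit set `B`, are
  pairwise and mutually disjoint, and cover `B` (the short A-window IS this covering) — `hHB hAB hdisjH hdisjA hdisjHA hcov`;
* the ONE ARITHMETIC INPUT `Σ_{V ∈ B} ω V = 0` (★ Lit `sum_normSign_repr_eq_zero` ∕ ★ LH4-p14's shell sums at instantiation) — `hω`;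
* finiteness of the level sets (the letters' `_hfinLS`, `_hfinLS'` VERBATIM) — used ONLY to discharge ★ p864238's empty-cell letters `n = 0 → X = 0` (§1: a finite cell of
  weighted size `0` carries weight `0` on every member, so both labelled partial sums vanish) — so the assembler supplies NO `h0`.
PROOF.  ★ p864238 `cellValue_eq_mul_sum_of_mul_card` per cell (with §1 for `h0`) feeds ★ `sum_window_eq_sum_window_of_digit_partition` at `c := k_H · p_H`.
WHAT IS NOT CLAIMED: any K6-0 instance, the density, the partition, the digit sum — all HYPOTHESES; ‹CORE›∕‹CORE-3›∕‹CORE-ODD›, β₂ stay OPEN letters until the assembler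
(`coreOdd_holds`, `core3_holds`: `intro …; exact coreWindow_of_perCellLaws … (hmulH := fun i hi => ★K6-0 …) …`) supplies them.
HONEST LABEL.  Count-neutral bookkeeping; nothing printed is asserted; `HC_CM` is proved only modulo the 7 printed citations (2 remaining named inputs: hLiu418 =
`stmt-HodgeConjecture-24832`, h413 = `stmt-HodgeConjecture-24833`) until rung 0 closes.
## References
* [Kottwitz1986BaseChangeUnits] R. E. Kottwitz, *Base change for unit elements of Hecke algebras*, Compositio Math. 60 (1986): §1 pp. 240–241 (cell-by-cell fixed-lattice counts).
* [LabesseLanglands1979] J.-P. Labesse, R. P. Langlands, *L-indistinguishability for SL(2)*, Canad. J. Math. 31 (1979): §2 (2.2) p. 9 (κ-signed counts).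
* [Rogawski1990] J. D. Rogawski, *Automorphic Representations of Unitary Groups in Three Variables*, Ann. of Math. Stud. 123 (1990): §4.9 Prop. 4.9.1 (b) p. 55 (the labelled census).
-/

set_option autoImplicit false

namespace Summit.HodgeConjecture.HodgeConjecture.Cruxes.H413.F0P3cDyRamCoreOfPerCellLaws

open scoped Valued WithZero
open Finset
open Summit.HodgeConjecture.HodgeConjecture.Cruxes.H413.F0P3cDyRamToricCensusDefs
open Summit.HodgeConjecture.HodgeConjecture.Cruxes.H413.F0P3cDyRamCoreWindowOfDigitSums (cellValue_eq_mul_sum_of_mul_card sum_window_eq_sum_window_of_digit_partition)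

/-! ## §1 The empty-cell letter of ★ p864238 is automatic on a finite cell -/

/-- **A FINITE CELL OF WEIGHTED SIZE ZERO HAS LABELLED COUNT ZERO.**  For a finite set `s`, an `ℕ`-valued weight `w` with `Σᶠ_{s} w = 0` (cast to `ℤ`) and any two label sets `P`, `Q`:
`Σᶠ_{s ∩ P} w − Σᶠ_{s ∩ Q} w = 0` — every member weighs `0`.  (Discharges the `h0` letters of ★ p864238 `cellValue_eq_mul_sum_of_mul_card` ∕ `sum_window_eq_sum_window_of_perCellLaw`.)
[cite: Kottwitz1986BaseChangeUnits, §1 pp. 240–241] -/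
theorem finsumDiff_eq_zero_of_finsum_eq_zero {X : Type*} {s : Set X} (hs : s.Finite) (P Q : Set X) (w : X → ℕ)
    (h0 : ((∑ᶠ x ∈ s, w x : ℕ) : ℤ) = 0) :
    ((∑ᶠ x ∈ s ∩ P, w x : ℕ) : ℤ) - ((∑ᶠ x ∈ s ∩ Q, w x : ℕ) : ℤ) = 0 := by
  have h0' : ∑ᶠ x ∈ s, w x = 0 := by exact_mod_cast h0
  rw [finsum_mem_eq_finite_toFinset_sum w hs, Finset.sum_eq_zero_iff_of_nonneg (fun _ _ => Nat.zero_le _)] at h0'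
  have hz : ∀ x ∈ s, w x = 0 := fun x hx => h0' x (hs.mem_toFinset.2 hx)
  have hP : ∑ᶠ x ∈ s ∩ P, w x = 0 := finsum_mem_of_eqOn_zero (fun x hx => hz x hx.1)
  have hQ : ∑ᶠ x ∈ s ∩ Q, w x = 0 := finsum_mem_of_eqOn_zero (fun x hx => hz x hx.1)
  rw [hP, hQ, Nat.cast_zero, sub_zero]

/-! ## §2 HEAD — the CORE window identity from the per-cell laws -/

/-- **HEAD — «THE CORE WINDOW IDENTITY FROM THE PER-CELL LAWS» (K6-(e)).**  Cells `C_t(i) = levelSetDep ρ Θ α ϖE h_t (b + 2i) b μ` (`h_H = h`, `h_A = h'`), weights `f`, `f'`, label sets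
`PH QH` ∕ `PA QA`, windows `IH IA`, digit set `B`, counted ∕ labelled digit families `SH ⊇ S'H`, `SA ⊇ S'A`, a label character `ω`, signs `pH pA`, densities `kH kA`.  HYPOTHESES: the
K6-0 law per listed cell in ★ p864195 HEAD′'s output shape (`hmulH`, `hmulA`), ‹K6-(f)› per literal (`hkH`, `hkA`), the sign letter `kA·pA = −(kH·pH)` (`hp`), the K6-(d) partition
of `B` by the labelled families (`hHB … hcov`), `Σ_B ω = 0` (`hω`), and the letters' finiteness `hfinLS`, `hfinLS'`.  THEN
`Σ_{i ∈ IH} (Σᶠ_{C_H(i) ∩ PH} f b (b+2i) − Σᶠ_{C_H(i) ∩ QH} f b (b+2i)) = Σ_{i ∈ IA} (Σᶠ_{C_A(i) ∩ PA} f' b (b+2i) − Σᶠ_{C_A(i) ∩ QA} f' b (b+2i))` — the conclusion of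
‹CORE›∕‹CORE-3›∕‹CORE-ODD› at `ϖE := jE ϖ`, `μ := lam − jE u₀₀`, `IH := range ((jl − m)∕2 + 1)`, `IA := range (min ((jl − m)∕2 + 1) d)`, `PH := {Λ ∣ ∃ B, … m⋆ … ∧ VS = X₊}`, ….
[cite: Kottwitz1986BaseChangeUnits, §1 pp. 240–241] [cite: LabesseLanglands1979, §2 (2.2) p. 9] [cite: Rogawski1990, §4.9 Prop. 4.9.1 (b) p. 55] -/
theorem coreWindow_of_perCellLaws {M : Type*} [Field M] [Valued M ℤᵐ⁰] {D : Type*} [DecidableEq D]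
    (ρ Θ : M →+* M) (α ϖE h h' μ : M) (f f' : ℕ → ℕ → AddSubgroup M → ℕ) (b : ℕ) (PH QH PA QA : Set (AddSubgroup M))
    (hfinLS : ∀ j a, (levelSet ρ Θ α ϖE h j a).Finite) (hfinLS' : ∀ j a, (levelSet ρ Θ α ϖE h' j a).Finite)
    (IH IA : Finset ℕ) (B : Finset D) (SH SA S'H S'A : ℕ → Finset D) (ω : D → ℤ) (pH pA kH kA : ℤ)
    (hsubH : ∀ i ∈ IH, S'H i ⊆ SH i) (hsubA : ∀ i ∈ IA, S'A i ⊆ SA i)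
    -- (K6-0) the per-cell laws, ★ p864195 HEAD′'s output shape
    (hmulH : ∀ i ∈ IH,
      (((∑ᶠ Λ ∈ levelSetDep ρ Θ α ϖE h (b + 2 * i) b μ ∩ PH, f b (b + 2 * i) Λ : ℕ) : ℤ) -
            ((∑ᶠ Λ ∈ levelSetDep ρ Θ α ϖE h (b + 2 * i) b μ ∩ QH, f b (b + 2 * i) Λ : ℕ) : ℤ)) * ((SH i).card : ℤ) =
        ((∑ᶠ Λ ∈ levelSetDep ρ Θ α ϖE h (b + 2 * i) b μ, f b (b + 2 * i) Λ : ℕ) : ℤ) * (pH * ∑ V ∈ S'H i, ω V))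
    (hmulA : ∀ i ∈ IA,
      (((∑ᶠ Λ ∈ levelSetDep ρ Θ α ϖE h' (b + 2 * i) b μ ∩ PA, f' b (b + 2 * i) Λ : ℕ) : ℤ) -
            ((∑ᶠ Λ ∈ levelSetDep ρ Θ α ϖE h' (b + 2 * i) b μ ∩ QA, f' b (b + 2 * i) Λ : ℕ) : ℤ)) * ((SA i).card : ℤ) =
        ((∑ᶠ Λ ∈ levelSetDep ρ Θ α ϖE h' (b + 2 * i) b μ, f' b (b + 2 * i) Λ : ℕ) : ℤ) * (pA * ∑ V ∈ S'A i, ω V))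
    -- ‹K6-(f) UNIFORM DENSITY›, one density per literal
    (hkH : ∀ i ∈ IH, ((∑ᶠ Λ ∈ levelSetDep ρ Θ α ϖE h (b + 2 * i) b μ, f b (b + 2 * i) Λ : ℕ) : ℤ) = kH * ((SH i).card : ℤ))
    (hkA : ∀ i ∈ IA, ((∑ᶠ Λ ∈ levelSetDep ρ Θ α ϖE h' (b + 2 * i) b μ, f' b (b + 2 * i) Λ : ℕ) : ℤ) = kA * ((SA i).card : ℤ))
    -- the sign letter
    (hp : kA * pA = -(kH * pH))
    -- the K6-(d) digit partition
    (hHB : ∀ i ∈ IH, S'H i ⊆ B) (hAB : ∀ i ∈ IA, S'A i ⊆ B)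
    (hdisjH : (IH : Set ℕ).PairwiseDisjoint S'H) (hdisjA : (IA : Set ℕ).PairwiseDisjoint S'A)
    (hdisjHA : ∀ i ∈ IH, ∀ i' ∈ IA, Disjoint (S'H i) (S'A i'))
    (hcov : ∀ V ∈ B, (∃ i ∈ IH, V ∈ S'H i) ∨ (∃ i ∈ IA, V ∈ S'A i))
    -- the one arithmetic input
    (hω : ∑ V ∈ B, ω V = 0) :
    ∑ i ∈ IH,
        (((∑ᶠ Λ ∈ levelSetDep ρ Θ α ϖE h (b + 2 * i) b μ ∩ PH, f b (b + 2 * i) Λ : ℕ) : ℤ) -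
          ((∑ᶠ Λ ∈ levelSetDep ρ Θ α ϖE h (b + 2 * i) b μ ∩ QH, f b (b + 2 * i) Λ : ℕ) : ℤ)) =
      ∑ i ∈ IA,
        (((∑ᶠ Λ ∈ levelSetDep ρ Θ α ϖE h' (b + 2 * i) b μ ∩ PA, f' b (b + 2 * i) Λ : ℕ) : ℤ) -
          ((∑ᶠ Λ ∈ levelSetDep ρ Θ α ϖE h' (b + 2 * i) b μ ∩ QA, f' b (b + 2 * i) Λ : ℕ) : ℤ)) := by
  refine sum_window_eq_sum_window_of_digit_partition B IH IA S'H S'A _ _ ω (kH * pH) (fun i hi => ?_) (fun i hi => ?_)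
    hHB hAB hdisjH hdisjA hdisjHA hcov hω
  · exact cellValue_eq_mul_sum_of_mul_card (SH i) (S'H i) (hsubH i hi) ω _ _ pH kH (hmulH i hi) (hkH i hi)
      (finsumDiff_eq_zero_of_finsum_eq_zero ((hfinLS (b + 2 * i) b).subset (levelSetDep_subset ρ Θ α ϖE h (b + 2 * i) b μ)) PH QH
        (fun Λ => f b (b + 2 * i) Λ))
  · rw [cellValue_eq_mul_sum_of_mul_card (SA i) (S'A i) (hsubA i hi) ω _ _ pA kA (hmulA i hi) (hkA i hi)
      (finsumDiff_eq_zero_of_finsum_eq_zero ((hfinLS' (b + 2 * i) b).subset (levelSetDep_subset ρ Θ α ϖE h' (b + 2 * i) b μ)) PA QA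
        (fun Λ => f' b (b + 2 * i) Λ)), hp]

/-! ## §3 (ED. 2) Per cell, in the letters' currency: K6-0 + density ⟹ the SOLVED cell value `X = (k·p)·Σ_{S′} ω` (no `h0`) -/

/-- **PER-CELL ADAPTER IN THE LETTERS' CURRENCY (ED. 2).**  For ONE cell `levelSetDep ρ Θ α ϖE hh j b μ` (any `j`, `b`; finite through `hfin`), weight `f b j`, label sets `P`, `Q`,
counted ∕ labelled digit sets `S ⊇ S′`: the K6-0 law `X·#S = n·(p·Σ_{S′} ω)` (★ p864195 HEAD′'s output shape) and the density letter `n = k·#S` give `X = (k·p)·Σ_{V ∈ S′} ω V` — ★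
p864238 `cellValue_eq_mul_sum_of_mul_card` with its empty-cell letter discharged by §1.  (Feeds §4's `hXH`∕`hXA` at `c_t := k_t·p_t`.)
[cite: Kottwitz1986BaseChangeUnits, §1 pp. 240–241] [cite: LabesseLanglands1979, §2 (2.2) p. 9] -/
theorem cellValue_of_perCellLaw {M : Type*} [Field M] [Valued M ℤᵐ⁰] {D : Type*}
    (ρ Θ : M →+* M) (α ϖE hh μ : M) (f : ℕ → ℕ → AddSubgroup M → ℕ) (j b : ℕ) (P Q : Set (AddSubgroup M))
    (hfin : (levelSet ρ Θ α ϖE hh j b).Finite) (S S' : Finset D) (hS' : S' ⊆ S) (ω : D → ℤ) (p k : ℤ)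
    (hmul : (((∑ᶠ Λ ∈ levelSetDep ρ Θ α ϖE hh j b μ ∩ P, f b j Λ : ℕ) : ℤ) -
          ((∑ᶠ Λ ∈ levelSetDep ρ Θ α ϖE hh j b μ ∩ Q, f b j Λ : ℕ) : ℤ)) * (S.card : ℤ) =
        ((∑ᶠ Λ ∈ levelSetDep ρ Θ α ϖE hh j b μ, f b j Λ : ℕ) : ℤ) * (p * ∑ V ∈ S', ω V))
    (hk : ((∑ᶠ Λ ∈ levelSetDep ρ Θ α ϖE hh j b μ, f b j Λ : ℕ) : ℤ) = k * (S.card : ℤ)) :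
    ((∑ᶠ Λ ∈ levelSetDep ρ Θ α ϖE hh j b μ ∩ P, f b j Λ : ℕ) : ℤ) -
        ((∑ᶠ Λ ∈ levelSetDep ρ Θ α ϖE hh j b μ ∩ Q, f b j Λ : ℕ) : ℤ) = k * p * ∑ V ∈ S', ω V :=
  cellValue_eq_mul_sum_of_mul_card S S' hS' ω _ _ p k hmul hk
    (finsumDiff_eq_zero_of_finsum_eq_zero (hfin.subset (levelSetDep_subset ρ Θ α ϖE hh j b μ)) P Q (fun Λ => f b j Λ))

/-! ## §4 (ED. 2) HEAD₂ — the CORE window identity from SOLVED cell values (terminal and balanced cells owe no density letter) -/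

/-- **HEAD₂ — «THE CORE WINDOW IDENTITY FROM THE CELL VALUES» (K6-(e) ED. 2, K6 DESK WORD #1 (e)).**  Same cells, weights, label sets and windows as HEAD §2, but the per-cell
input is the SOLVED value `X_t(i) = c_t · Σ_{V ∈ S′_t i} ω V` with ONE constant `c_t` per literal (`hXH`, `hXA` — from §3 at `c_t = k_t·p_t` on inside cells; `X = 0` with `S′ = ∅` on
the TERMINAL cell; any cell with `Σ_{S′} ω = 0` and `X = 0` fits every `c_t`) and the sign letter `cA = −cH` (`hc`); plus the K6-(d) partition of `B` by the labelled families and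
`Σ_B ω = 0`.  THEN the CORE conclusion (same bytes as HEAD §2's).  No finiteness, no density letter here. [cite: Kottwitz1986BaseChangeUnits, §1 pp. 240–241]
[cite: LabesseLanglands1979, §2 (2.2) p. 9] [cite: Rogawski1990, §4.9 Prop. 4.9.1 (b) p. 55] -/
theorem coreWindow_of_cellValues {M : Type*} [Field M] [Valued M ℤᵐ⁰] {D : Type*} [DecidableEq D]
    (ρ Θ : M →+* M) (α ϖE h h' μ : M) (f f' : ℕ → ℕ → AddSubgroup M → ℕ) (b : ℕ) (PH QH PA QA : Set (AddSubgroup M))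
    (IH IA : Finset ℕ) (B : Finset D) (S'H S'A : ℕ → Finset D) (ω : D → ℤ) (cH cA : ℤ)
    -- the solved cell values, one constant per literal
    (hXH : ∀ i ∈ IH,
      ((∑ᶠ Λ ∈ levelSetDep ρ Θ α ϖE h (b + 2 * i) b μ ∩ PH, f b (b + 2 * i) Λ : ℕ) : ℤ) -
          ((∑ᶠ Λ ∈ levelSetDep ρ Θ α ϖE h (b + 2 * i) b μ ∩ QH, f b (b + 2 * i) Λ : ℕ) : ℤ) = cH * ∑ V ∈ S'H i, ω V)
    (hXA : ∀ i ∈ IA,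
      ((∑ᶠ Λ ∈ levelSetDep ρ Θ α ϖE h' (b + 2 * i) b μ ∩ PA, f' b (b + 2 * i) Λ : ℕ) : ℤ) -
          ((∑ᶠ Λ ∈ levelSetDep ρ Θ α ϖE h' (b + 2 * i) b μ ∩ QA, f' b (b + 2 * i) Λ : ℕ) : ℤ) = cA * ∑ V ∈ S'A i, ω V)
    -- the sign letter
    (hc : cA = -cH)
    -- the K6-(d) digit partition
    (hHB : ∀ i ∈ IH, S'H i ⊆ B) (hAB : ∀ i ∈ IA, S'A i ⊆ B)
    (hdisjH : (IH : Set ℕ).PairwiseDisjoint S'H) (hdisjA : (IA : Set ℕ).PairwiseDisjoint S'A)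
    (hdisjHA : ∀ i ∈ IH, ∀ i' ∈ IA, Disjoint (S'H i) (S'A i'))
    (hcov : ∀ V ∈ B, (∃ i ∈ IH, V ∈ S'H i) ∨ (∃ i ∈ IA, V ∈ S'A i))
    -- the one arithmetic input
    (hω : ∑ V ∈ B, ω V = 0) :
    ∑ i ∈ IH,
        (((∑ᶠ Λ ∈ levelSetDep ρ Θ α ϖE h (b + 2 * i) b μ ∩ PH, f b (b + 2 * i) Λ : ℕ) : ℤ) -
          ((∑ᶠ Λ ∈ levelSetDep ρ Θ α ϖE h (b + 2 * i) b μ ∩ QH, f b (b + 2 * i) Λ : ℕ) : ℤ)) =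
      ∑ i ∈ IA,
        (((∑ᶠ Λ ∈ levelSetDep ρ Θ α ϖE h' (b + 2 * i) b μ ∩ PA, f' b (b + 2 * i) Λ : ℕ) : ℤ) -
          ((∑ᶠ Λ ∈ levelSetDep ρ Θ α ϖE h' (b + 2 * i) b μ ∩ QA, f' b (b + 2 * i) Λ : ℕ) : ℤ)) := by
  subst hc
  exact sum_window_eq_sum_window_of_digit_partition B IH IA S'H S'A _ _ ω cH hXH hXA hHB hAB hdisjH hdisjA hdisjHA hcov hω

/-! ## §5 (ED. 3) The K6-(d) partition letters from SPHERE INDEX and CLASS (the assembler's bookkeeping, once for all letters) -/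

/-- **THE PARTITION LETTERS FROM SPHERE INDEX AND CLASS (ED. 3).**  If every labelled digit of the H-cell `i` lies in `B`, on the sphere of index `i` and in class `H` (`hH`), likewise for
`A` (`hA`), the sphere index of a digit of `B` is UNIQUE (`hSPH` — ★ p864361 `eq_of_sphereClause_of_sphereClause`) and the two classes are DISJOINT on `B` (`hHA` — K6-(d′), the
index-two dichotomy), then the five structural letters of HEAD ∕ HEAD₂ hold: `S′_H i, S′_A i ⊆ B`, each family pairwise disjoint, the two families mutually disjoint.  (The covering
letter `hcov` is content — sphere cover + class totality + the A-window cut — and stays the assembler's.) [cite: Kottwitz1986BaseChangeUnits, §1 pp. 240–241] -/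
theorem partitionLetters_of_sphere_class {D : Type*} [DecidableEq D] (B : Finset D) (IH IA : Finset ℕ) (S'H S'A : ℕ → Finset D)
    (SPH : ℕ → D → Prop) (CH CA : D → Prop)
    (hH : ∀ i ∈ IH, ∀ V ∈ S'H i, V ∈ B ∧ SPH i V ∧ CH V) (hA : ∀ i ∈ IA, ∀ V ∈ S'A i, V ∈ B ∧ SPH i V ∧ CA V)
    (hSPH : ∀ V ∈ B, ∀ i i' : ℕ, SPH i V → SPH i' V → i = i') (hHA : ∀ V ∈ B, CH V → ¬ CA V) :
    (∀ i ∈ IH, S'H i ⊆ B) ∧ (∀ i ∈ IA, S'A i ⊆ B) ∧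
      (IH : Set ℕ).PairwiseDisjoint S'H ∧ (IA : Set ℕ).PairwiseDisjoint S'A ∧ (∀ i ∈ IH, ∀ i' ∈ IA, Disjoint (S'H i) (S'A i')) := by
  refine ⟨fun i hi V hV => (hH i hi V hV).1, fun i hi V hV => (hA i hi V hV).1, ?_, ?_, ?_⟩
  · intro i hi i' hi' hne
    rw [Function.onFun, Finset.disjoint_left]
    intro V hV hV'
    obtain ⟨hB, hS, -⟩ := hH i hi V hV
    obtain ⟨-, hS', -⟩ := hH i' hi' V hV'
    exact hne (hSPH V hB i i' hS hS')
  · intro i hi i' hi' hne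
    rw [Function.onFun, Finset.disjoint_left]
    intro V hV hV'
    obtain ⟨hB, hS, -⟩ := hA i hi V hV
    obtain ⟨-, hS', -⟩ := hA i' hi' V hV'
    exact hne (hSPH V hB i i' hS hS')
  · intro i hi i' hi'
    rw [Finset.disjoint_left]
    intro V hV hV'
    obtain ⟨hB, -, hC⟩ := hH i hi V hV
    obtain ⟨-, -, hC'⟩ := hA i' hi' V hV'
    exact hHA V hB hC hC'

/-- **HEAD₃ — «THE CORE WINDOW IDENTITY FROM THE CELL VALUES, SPHERE-AND-CLASS FORM» (K6-(e) ED. 3).**  HEAD₂ with its five structural partition letters replaced by the two membership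
reads `hH`, `hA` («a labelled digit of cell `(t, i)` lies in `B`, on sphere `i`, in class `t`»), sphere-index uniqueness `hSPH` (★ p864361 §7) and class disjointness `hHA` (K6-(d′));
the covering letter `hcov` and the digit sum `hω` remain.  THEN the CORE conclusion (same bytes). [cite: Kottwitz1986BaseChangeUnits, §1 pp. 240–241]
[cite: LabesseLanglands1979, §2 (2.2) p. 9] [cite: Rogawski1990, §4.9 Prop. 4.9.1 (b) p. 55] -/
theorem coreWindow_of_cellValues_sphere {M : Type*} [Field M] [Valued M ℤᵐ⁰] {D : Type*} [DecidableEq D]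
    (ρ Θ : M →+* M) (α ϖE h h' μ : M) (f f' : ℕ → ℕ → AddSubgroup M → ℕ) (b : ℕ) (PH QH PA QA : Set (AddSubgroup M))
    (IH IA : Finset ℕ) (B : Finset D) (S'H S'A : ℕ → Finset D) (ω : D → ℤ) (cH cA : ℤ)
    -- the solved cell values, one constant per literal
    (hXH : ∀ i ∈ IH,
      ((∑ᶠ Λ ∈ levelSetDep ρ Θ α ϖE h (b + 2 * i) b μ ∩ PH, f b (b + 2 * i) Λ : ℕ) : ℤ) -
          ((∑ᶠ Λ ∈ levelSetDep ρ Θ α ϖE h (b + 2 * i) b μ ∩ QH, f b (b + 2 * i) Λ : ℕ) : ℤ) = cH * ∑ V ∈ S'H i, ω V)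
    (hXA : ∀ i ∈ IA,
      ((∑ᶠ Λ ∈ levelSetDep ρ Θ α ϖE h' (b + 2 * i) b μ ∩ PA, f' b (b + 2 * i) Λ : ℕ) : ℤ) -
          ((∑ᶠ Λ ∈ levelSetDep ρ Θ α ϖE h' (b + 2 * i) b μ ∩ QA, f' b (b + 2 * i) Λ : ℕ) : ℤ) = cA * ∑ V ∈ S'A i, ω V)
    -- the sign letter
    (hc : cA = -cH)
    -- sphere and class reads of the labelled digits
    (SPH : ℕ → D → Prop) (CH CA : D → Prop)
    (hH : ∀ i ∈ IH, ∀ V ∈ S'H i, V ∈ B ∧ SPH i V ∧ CH V) (hA : ∀ i ∈ IA, ∀ V ∈ S'A i, V ∈ B ∧ SPH i V ∧ CA V)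
    (hSPH : ∀ V ∈ B, ∀ i i' : ℕ, SPH i V → SPH i' V → i = i') (hHA : ∀ V ∈ B, CH V → ¬ CA V)
    (hcov : ∀ V ∈ B, (∃ i ∈ IH, V ∈ S'H i) ∨ (∃ i ∈ IA, V ∈ S'A i))
    -- the one arithmetic input
    (hω : ∑ V ∈ B, ω V = 0) :
    ∑ i ∈ IH,
        (((∑ᶠ Λ ∈ levelSetDep ρ Θ α ϖE h (b + 2 * i) b μ ∩ PH, f b (b + 2 * i) Λ : ℕ) : ℤ) -
          ((∑ᶠ Λ ∈ levelSetDep ρ Θ α ϖE h (b + 2 * i) b μ ∩ QH, f b (b + 2 * i) Λ : ℕ) : ℤ)) =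
      ∑ i ∈ IA,
        (((∑ᶠ Λ ∈ levelSetDep ρ Θ α ϖE h' (b + 2 * i) b μ ∩ PA, f' b (b + 2 * i) Λ : ℕ) : ℤ) -
          ((∑ᶠ Λ ∈ levelSetDep ρ Θ α ϖE h' (b + 2 * i) b μ ∩ QA, f' b (b + 2 * i) Λ : ℕ) : ℤ)) := by
  obtain ⟨hHB, hAB, hdisjH, hdisjA, hdisjHA⟩ := partitionLetters_of_sphere_class B IH IA S'H S'A SPH CH CA hH hA hSPH hHA
  exact coreWindow_of_cellValues ρ Θ α ϖE h h' μ f f' b PH QH PA QA IH IA B S'H S'A ω cH cA hXH hXA hc hHB hAB hdisjH hdisjA hdisjHA hcov hω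

/-! ## §6 (ED. 4) HEAD₀ — the CORE window identity from cell SUMS in any currencies (inside cells and the top cell may use different digit systems) -/

/-- **HEAD₀ — «THE CORE WINDOW IDENTITY FROM CELL SUMS» (K6-(e) ED. 4, K6 DESK WORD #13 (d)).**  The most abstract spine: per listed cell the SOLVED value `X_t(i) = c_t · s_t i` for ANY
integers `s_t i` (`hXH`, `hXA` — e.g. `s = Σ_{S′} ω` from §3 on inside cells in the INSIDE chart, the top cell's labelled `NX`-sum in the TOP chart, `0` for an empty ∕ terminal cell),
ONE constant per literal with the sign letter `cA = −cH` (`hc`), and ONE arithmetic input `Σ_{i ∈ IH} s_H i + Σ_{i ∈ IA} s_A i = 0` (`hs` — assembled from ★ p864238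
`sum_biUnion_add_sum_biUnion_eq_sum` + ★ LH4-p11 (g) on the inside digit system and the top-sphere sum separately; no common digit type needed).  THEN the CORE conclusion (same bytes as
HEAD §2's). [cite: Kottwitz1986BaseChangeUnits, §1 pp. 240–241] [cite: LabesseLanglands1979, §2 (2.2) p. 9] [cite: Rogawski1990, §4.9 Prop. 4.9.1 (b) p. 55] -/
theorem coreWindow_of_cellSums {M : Type*} [Field M] [Valued M ℤᵐ⁰]
    (ρ Θ : M →+* M) (α ϖE h h' μ : M) (f f' : ℕ → ℕ → AddSubgroup M → ℕ) (b : ℕ) (PH QH PA QA : Set (AddSubgroup M))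
    (IH IA : Finset ℕ) (sH sA : ℕ → ℤ) (cH cA : ℤ)
    -- the solved cell values, one constant per literal, arbitrary cell sums
    (hXH : ∀ i ∈ IH,
      ((∑ᶠ Λ ∈ levelSetDep ρ Θ α ϖE h (b + 2 * i) b μ ∩ PH, f b (b + 2 * i) Λ : ℕ) : ℤ) -
          ((∑ᶠ Λ ∈ levelSetDep ρ Θ α ϖE h (b + 2 * i) b μ ∩ QH, f b (b + 2 * i) Λ : ℕ) : ℤ) = cH * sH i)
    (hXA : ∀ i ∈ IA,
      ((∑ᶠ Λ ∈ levelSetDep ρ Θ α ϖE h' (b + 2 * i) b μ ∩ PA, f' b (b + 2 * i) Λ : ℕ) : ℤ) -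
          ((∑ᶠ Λ ∈ levelSetDep ρ Θ α ϖE h' (b + 2 * i) b μ ∩ QA, f' b (b + 2 * i) Λ : ℕ) : ℤ) = cA * sA i)
    -- the sign letter
    (hc : cA = -cH)
    -- the one arithmetic input
    (hs : ∑ i ∈ IH, sH i + ∑ i ∈ IA, sA i = 0) :
    ∑ i ∈ IH,
        (((∑ᶠ Λ ∈ levelSetDep ρ Θ α ϖE h (b + 2 * i) b μ ∩ PH, f b (b + 2 * i) Λ : ℕ) : ℤ) -
          ((∑ᶠ Λ ∈ levelSetDep ρ Θ α ϖE h (b + 2 * i) b μ ∩ QH, f b (b + 2 * i) Λ : ℕ) : ℤ)) =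
      ∑ i ∈ IA,
        (((∑ᶠ Λ ∈ levelSetDep ρ Θ α ϖE h' (b + 2 * i) b μ ∩ PA, f' b (b + 2 * i) Λ : ℕ) : ℤ) -
          ((∑ᶠ Λ ∈ levelSetDep ρ Θ α ϖE h' (b + 2 * i) b μ ∩ QA, f' b (b + 2 * i) Λ : ℕ) : ℤ)) := by
  rw [Finset.sum_congr rfl hXH, Finset.sum_congr rfl hXA, ← Finset.mul_sum, ← Finset.mul_sum, hc, ← sub_eq_zero, neg_mul, sub_neg_eq_add, ← mul_add,
    hs, mul_zero]

end Summit.HodgeConjecture.HodgeConjecture.Cruxes.H413.F0P3cDyRamCoreOfPerCellLaws
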